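import Summits.ResolutionOfSingularities.ResolutionOfSingularities.Theorems.FrobeniusLadderFInjectiveMacaulayficationT11Char3Frame
import HarnessLib

/-!
# E7 — THE T₁₁/3 HEADLINE MODULO DATA: the crux conclusion for `T₁₁⁺ ⊂ 𝔸⁵_k`, every field `k` of characteristic 3, from the three
# data deliveries of `T11Char3Frame.t11_originPointFixable_char3_of_data`
# (crux `FInjectiveMacaulayfication` stmt-ResolutionOfSingularities-15315, chain w45a; E7 T₁₁/3)

[OURS · L1 W4.5a · res-L1-w45a-lead-1 gen 5] Support file (`--supports stmt-ResolutionOfSingularities-15315 --as helper`); NOT a statement of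
any manuscript; AI-written, weaker than expert review. See `…T11Char3Frame` for the roles of the data hypotheses (`hstd`/`hoff` = level-1 model
clauses, res-L1-w45a-stub-5's producers on res-L1-w45a-stub-4's p = 3 cell texts; `hR3` = res-type-034's curve data; `hblock64`/`hblock66` =
the level-2 certificate blocks). No definitions, no named facts. [folklore glue]
-/

-- single-problem summit: the doubled namespace component is forced
set_option linter.dupNamespace false

noncomputable section

namespace Summit.ResolutionOfSingularities.ResolutionOfSingularities.Theorems.FInjectiveMacaulayfication.T11Char3Frame

open AlgebraicGeometry CategoryTheory TopologicalSpace Literature.AlgebraicGeometry.Resolution MvPolynomial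
open Summit.ResolutionOfSingularities.ResolutionOfSingularities.Theorems.FInjectiveMacaulayfication

/-! ## §3 The crux conclusion for `T₁₁⁺` over every field of characteristic 3, modulo the same data -/

set_option maxHeartbeats 1600000 in
/-- **THE W4.5a T₁₁/3 HEADLINE MODULO DATA — the crux statement `FrobeniusLadder.FInjectiveMacaulayfication` for
`X = T₁₁⁺ = V(Φ − y² − x³, z² + Φ³ + x¹¹ + w⁷) ⊂ 𝔸⁵_k`, EVERY field `k` of characteristic 3**, from the three data deliveries of
`t11_originPointFixable_char3_of_data` (level-1 model clauses, curve data, level-2 blocks): the `Ideal.span {T₁₁}` base is moved to the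
`Fin 1`-range base by `subst`, then res-L1-w45a-stub-2's stalk transport `T11PlusOriginTransportStalk.t11Plus_h0_of_hypersurface_h0` and
res-L1-w45a-stub-3's door `T11SpecimenDoorChar3.fInjectiveMacaulayfication_T11plus_char3_of_h0`. [OURS · folklore glue] -/
theorem fInjectiveMacaulayfication_T11plus_char3_of_data (k : Type) [Field k] [CharP k 3] (f : MvPolynomial (Fin 4) k)
    (hf : f = (X 2 ^ 2 + (X 1 ^ 2 + X 0 ^ 3) ^ 3 + X 0 ^ 11 + X 3 ^ 7 : MvPolynomial (Fin 4) k)) (hf0 : constantCoeff f = 0)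
    -- LEVEL-1 MODEL CLAUSES (stub-5's producers on stub-4's cell texts)
    (hstd : ∀ c : Fin 87, T11Char3Poly.SSoff c = [] →
      ∀ (Q' : Ideal (MvPolynomial (Fin 4) k ⧸ Ideal.span {(KLocCellKit.evalL k (T11Char7Poly.G c))})) [Q'.IsMaximal],
        (∀ j ∈ (Finset.univ : Finset (Fin 4)), Ideal.Quotient.mk (Ideal.span {(KLocCellKit.evalL k (T11Char7Poly.G c))})
          (aeval (fun j : Fin 4 => ∏ i : Fin 4, (X i : MvPolynomial (Fin 4) k) ^ T11Char7Fan.V c i j) (X j : MvPolynomial (Fin 4) k)) ∈ Q') →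
        ∀ dd : ℕ, ringKrullDim (Localization.AtPrime Q') = dd → ∀ s : Fin dd → Localization.AtPrime Q',
          (Ideal.span (Set.range s)).radical.IsMaximal →
            RingTheory.Sequence.IsWeaklyRegular (Localization.AtPrime Q') (List.ofFn s) ∧
            ∀ y : Localization.AtPrime Q', (∃ e : ℕ, y ^ 3 ^ e ∈ Ideal.span
              ((fun z : Localization.AtPrime Q' => z ^ 3 ^ e) ''
                (Ideal.span (Set.range s) : Set (Localization.AtPrime Q')))) → y ∈ Ideal.span (Set.range s))
    (hoff : ∀ c : Fin 87, T11Char3Poly.SSoff c ≠ [] →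
      ∀ (Q' : Ideal (MvPolynomial (Fin 4) k ⧸ Ideal.span {(KLocCellKit.evalL k (T11Char7Poly.G c))})) [Q'.IsMaximal],
        (∀ j ∈ (Finset.univ : Finset (Fin 4)), Ideal.Quotient.mk (Ideal.span {(KLocCellKit.evalL k (T11Char7Poly.G c))})
          (aeval (fun j : Fin 4 => ∏ i : Fin 4, (X i : MvPolynomial (Fin 4) k) ^ T11Char7Fan.V c i j) (X j : MvPolynomial (Fin 4) k)) ∈ Q') →
        ¬ ((Ideal.span {x | x ∈ (T11Char3Poly.HS c).map (KLocCellKit.evalL k)}).map (Ideal.Quotient.mk (Ideal.span {(KLocCellKit.evalL k (T11Char7Poly.G c))}))) ≤ Q' →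
        ∀ dd : ℕ, ringKrullDim (Localization.AtPrime Q') = dd → ∀ s : Fin dd → Localization.AtPrime Q',
          (Ideal.span (Set.range s)).radical.IsMaximal →
            RingTheory.Sequence.IsWeaklyRegular (Localization.AtPrime Q') (List.ofFn s) ∧
            ∀ y : Localization.AtPrime Q', (∃ e : ℕ, y ^ 3 ^ e ∈ Ideal.span
              ((fun z : Localization.AtPrime Q' => z ^ 3 ^ e) ''
                (Ideal.span (Set.range s) : Set (Localization.AtPrime Q')))) → y ∈ Ideal.span (Set.range s))
    -- THE CURVE DATA (res-type-034's R3 data half), for any pinned sections isomorphisms and any (C1)-spec'd chart presentations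
    (hR3 : ∀ (e : ∀ c : Fin 87, Γ(affineBlowup (Ideal.span ((fun e : Fin 4 →₀ ℕ => Ideal.Quotient.mk (Ideal.span {f}) (monomial e (1 : k))) '' (T11Char7Fan.A : Set (Fin 4 →₀ ℕ)))), (Proj.basicOpen (reesGrading (Ideal.span ((fun e : Fin 4 →₀ ℕ => Ideal.Quotient.mk (Ideal.span {f}) (monomial e (1 : k))) '' (T11Char7Fan.A : Set (Fin 4 →₀ ℕ))))) (reesT (I := (Ideal.span ((fun e : Fin 4 →₀ ℕ => Ideal.Quotient.mk (Ideal.span {f}) (monomial e (1 : k))) '' (T11Char7Fan.A : Set (Fin 4 →₀ ℕ))))) (Ideal.Quotient.mk (Ideal.span {f}) (monomial (T11Char7Fan.m c) (1 : k))) (Ideal.subset_span ⟨T11Char7Fan.m c, T11Char7Fan.hmA c, rfl⟩ : (Ideal.Quotient.mk (Ideal.span {f}) (monomial (T11Char7Fan.m c) (1 : k))) ∈ (Ideal.span ((fun e : Fin 4 →₀ ℕ => Ideal.Quotient.mk (Ideal.span {f}) (monomial e (1 : k))) '' (T11Char7Fan.A : Set (Fin 4 →₀ ℕ)))))))) ≃+*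 ↥(blowupAlgebra (Ideal.span ((fun e : Fin 4 →₀ ℕ => Ideal.Quotient.mk (Ideal.span {f}) (monomial e (1 : k))) '' (T11Char7Fan.A : Set (Fin 4 →₀ ℕ)))) (Ideal.Quotient.mk (Ideal.span {f}) (monomial (T11Char7Fan.m c) (1 : k)))))
      (he₀ : ∀ (c : Fin 87) (gg : HomogeneousLocalization.Away (reesGrading (Ideal.span ((fun e : Fin 4 →₀ ℕ => Ideal.Quotient.mk (Ideal.span {f}) (monomial e (1 : k))) '' (T11Char7Fan.A : Set (Fin 4 →₀ ℕ))))) (reesT (I := (Ideal.span ((fun e : Fin 4 →₀ ℕ => Ideal.Quotient.mk (Ideal.span {f}) (monomial e (1 : k))) '' (T11Char7Fan.A : Set (Fin 4 →₀ ℕ))))) (Ideal.Quotient.mk (Ideal.span {f}) (monomial (T11Char7Fan.m c) (1 : k))) (Ideal.subset_span ⟨T11Char7Fan.m c, T11Char7Fan.hmA c, rfl⟩ : (Ideal.Quotient.mk (Ideal.span {f}) (monomial (T11Char7Fan.m c) (1 : k))) ∈ (Ideal.span ((fun e : Fin 4 →₀ ℕ => Ideal.Quotient.mk (Ideal.span {f})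 (monomial e (1 : k))) '' (T11Char7Fan.A : Set (Fin 4 →₀ ℕ))))))),
        e c ((Proj.basicOpenIsoAway (reesGrading (Ideal.span ((fun e : Fin 4 →₀ ℕ => Ideal.Quotient.mk (Ideal.span {f}) (monomial e (1 : k))) '' (T11Char7Fan.A : Set (Fin 4 →₀ ℕ))))) (reesT (I := (Ideal.span ((fun e : Fin 4 →₀ ℕ => Ideal.Quotient.mk (Ideal.span {f}) (monomial e (1 : k))) '' (T11Char7Fan.A : Set (Fin 4 →₀ ℕ))))) (Ideal.Quotient.mk (Ideal.span {f}) (monomial (T11Char7Fan.m c) (1 : k))) (Ideal.subset_span ⟨T11Char7Fan.m c, T11Char7Fan.hmA c, rfl⟩ : (Ideal.Quotient.mk (Ideal.span {f}) (monomial (T11Char7Fan.m c) (1 : k))) ∈ (Ideal.span ((fun e : Fin 4 →₀ ℕ => Ideal.Quotient.mk (Ideal.span {f}) (monomial e (1 : k))) '' (T11Char7Fan.A : Set (Fin 4 →₀ ℕ)))))) (reesT_mem (Ideal.Quotient.mk (Ideal.span {f}) (monomial (T11Char7Fan.m c) (1 : k))) (Ideal.subset_span ⟨T11Char7Fan.m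 c, T11Char7Fan.hmA c, rfl⟩ : (Ideal.Quotient.mk (Ideal.span {f}) (monomial (T11Char7Fan.m c) (1 : k))) ∈ (Ideal.span ((fun e : Fin 4 →₀ ℕ => Ideal.Quotient.mk (Ideal.span {f}) (monomial e (1 : k))) '' (T11Char7Fan.A : Set (Fin 4 →₀ ℕ)))))) Nat.one_pos).hom gg) =
          reesChartEquiv (Ideal.Quotient.mk (Ideal.span {f}) (monomial (T11Char7Fan.m c) (1 : k))) (Ideal.subset_span ⟨T11Char7Fan.m c, T11Char7Fan.hmA c, rfl⟩ : (Ideal.Quotient.mk (Ideal.span {f}) (monomial (T11Char7Fan.m c) (1 : k))) ∈ (Ideal.span ((fun e : Fin 4 →₀ ℕ => Ideal.Quotient.mk (Ideal.span {f}) (monomial e (1 : k))) '' (T11Char7Fan.A : Set (Fin 4 →₀ ℕ))))) gg)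
      (θ : ∀ c : Fin 87, (MvPolynomial (Fin 4) k ⧸ Ideal.span {(KLocCellKit.evalL k (T11Char7Poly.G c))}) ≃+* ↥(blowupAlgebra (Ideal.span ((fun e : Fin 4 →₀ ℕ => Ideal.Quotient.mk (Ideal.span {f}) (monomial e (1 : k))) '' (T11Char7Fan.A : Set (Fin 4 →₀ ℕ)))) (Ideal.Quotient.mk (Ideal.span {f}) (monomial (T11Char7Fan.m c) (1 : k)))))
      (hθ : ∀ (c : Fin 87) (j : Fin 4), ((θ c (Ideal.Quotient.mk (Ideal.span {(KLocCellKit.evalL k (T11Char7Poly.G c))}) (∏ i : Fin 4, (X i : MvPolynomial (Fin 4) k) ^ T11Char7Fan.V c i j))) :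
          Localization.Away (Ideal.Quotient.mk (Ideal.span {f}) (monomial (T11Char7Fan.m c) (1 : k)))) = algebraMap (MvPolynomial (Fin 4) k ⧸ Ideal.span {f}) (Localization.Away (Ideal.Quotient.mk (Ideal.span {f}) (monomial (T11Char7Fan.m c) (1 : k)))) (Ideal.Quotient.mk (Ideal.span {f}) (X j))),
      ∃ ξ : ↥(affineBlowup (Ideal.span ((fun e : Fin 4 →₀ ℕ => Ideal.Quotient.mk (Ideal.span {f}) (monomial e (1 : k))) '' (T11Char7Fan.A : Set (Fin 4 →₀ ℕ))))), (affineBlowup.π (Ideal.span ((fun e : Fin 4 →₀ ℕ => Ideal.Quotient.mk (Ideal.span {f}) (monomial e (1 : k))) '' (T11Char7Fan.A : Set (Fin 4 →₀ ℕ))))).base ξ = (⟨Ideal.span (Set.range fun i : Fin 4 => Ideal.Quotient.mk (Ideal.span {f}) (X i)), (origin_isMaximal f hf0).isPrime⟩ : ↥(Spec (.of (MvPolynomial (Fin 4) k ⧸ Ideal.span {f})))) ∧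
        (∀ c : Fin 87, T11Char3Poly.SSoff c ≠ [] → ((Scheme.IdealSheafData.vanishingIdeal (⟨closure ({ξ} : Set ↥(affineBlowup (Ideal.span ((fun e : Fin 4 →₀ ℕ => Ideal.Quotient.mk (Ideal.span {f}) (monomial e (1 : k))) '' (T11Char7Fan.A : Set (Fin 4 →₀ ℕ)))))), isClosed_closure⟩ : Closeds ↥(affineBlowup (Ideal.span ((fun e : Fin 4 →₀ ℕ => Ideal.Quotient.mk (Ideal.span {f}) (monomial e (1 : k))) '' (T11Char7Fan.A : Set (Fin 4 →₀ ℕ))))))).ideal (⟨(Proj.basicOpen (reesGrading (Ideal.span ((fun e : Fin 4 →₀ ℕ => Ideal.Quotient.mk (Ideal.span {f}) (monomial e (1 : k))) '' (T11Char7Fan.A : Set (Fin 4 →₀ ℕ))))) (reesT (I := (Ideal.span ((fun e : Fin 4 →₀ ℕ => Ideal.Quotient.mk (Ideal.span {f}) (monomial e (1 : k))) '' (T11Char7Fan.A : Set (Fin 4 →₀ ℕ))))) (Ideal.Quotient.mk (Ideal.span {f}) (monomial (T11Char7Fan.m c) (1 : k))) (Ideal.subset_span ⟨T11Char7Fan.m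 c, T11Char7Fan.hmA c, rfl⟩ : (Ideal.Quotient.mk (Ideal.span {f}) (monomial (T11Char7Fan.m c) (1 : k))) ∈ (Ideal.span ((fun e : Fin 4 →₀ ℕ => Ideal.Quotient.mk (Ideal.span {f}) (monomial e (1 : k))) '' (T11Char7Fan.A : Set (Fin 4 →₀ ℕ))))))), AffineBlowupChartFrame.isAffineOpen_basicOpen_reesT (Ideal.span ((fun e : Fin 4 →₀ ℕ => Ideal.Quotient.mk (Ideal.span {f}) (monomial e (1 : k))) '' (T11Char7Fan.A : Set (Fin 4 →₀ ℕ)))) (Ideal.Quotient.mk (Ideal.span {f}) (monomial (T11Char7Fan.m c) (1 : k))) (Ideal.subset_span ⟨T11Char7Fan.m c, T11Char7Fan.hmA c, rfl⟩ : (Ideal.Quotient.mk (Ideal.span {f}) (monomial (T11Char7Fan.m c) (1 : k))) ∈ (Ideal.span ((fun e : Fin 4 →₀ ℕ => Ideal.Quotient.mk (Ideal.span {f}) (monomial e (1 : k))) '' (T11Char7Fan.A : Set (Fin 4 →₀ ℕ)))))⟩ : (affineBlowup (Ideal.span ((fun e : Fin 4 →₀ ℕ => Ideal.Quotient.mk (Ideal.span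 {f}) (monomial e (1 : k))) '' (T11Char7Fan.A : Set (Fin 4 →₀ ℕ))))).affineOpens)).map (e c) ≤ (((Ideal.span {x | x ∈ (T11Char3Poly.HS c).map (KLocCellKit.evalL k)}).map (Ideal.Quotient.mk (Ideal.span {(KLocCellKit.evalL k (T11Char7Poly.G c))})))).map (θ c)) ∧
        ((Scheme.IdealSheafData.vanishingIdeal (⟨closure ({ξ} : Set ↥(affineBlowup (Ideal.span ((fun e : Fin 4 →₀ ℕ => Ideal.Quotient.mk (Ideal.span {f}) (monomial e (1 : k))) '' (T11Char7Fan.A : Set (Fin 4 →₀ ℕ)))))), isClosed_closure⟩ : Closeds ↥(affineBlowup (Ideal.span ((fun e : Fin 4 →₀ ℕ => Ideal.Quotient.mk (Ideal.span {f}) (monomial e (1 : k))) '' (T11Char7Fan.A : Set (Fin 4 →₀ ℕ))))))).ideal (⟨(Proj.basicOpen (reesGrading (Ideal.span ((fun e : Fin 4 →₀ ℕ => Ideal.Quotient.mk (Ideal.span {f}) (monomial e (1 : k))) '' (T11Char7Fan.A : Set (Fin 4 →₀ ℕ))))) (reesT (I := (Ideal.span ((fun e : Fin 4 →₀ ℕ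 => Ideal.Quotient.mk (Ideal.span {f}) (monomial e (1 : k))) '' (T11Char7Fan.A : Set (Fin 4 →₀ ℕ))))) (Ideal.Quotient.mk (Ideal.span {f}) (monomial (T11Char7Fan.m 64) (1 : k))) (Ideal.subset_span ⟨T11Char7Fan.m 64, T11Char7Fan.hmA 64, rfl⟩ : (Ideal.Quotient.mk (Ideal.span {f}) (monomial (T11Char7Fan.m 64) (1 : k))) ∈ (Ideal.span ((fun e : Fin 4 →₀ ℕ => Ideal.Quotient.mk (Ideal.span {f}) (monomial e (1 : k))) '' (T11Char7Fan.A : Set (Fin 4 →₀ ℕ))))))), AffineBlowupChartFrame.isAffineOpen_basicOpen_reesT (Ideal.span ((fun e : Fin 4 →₀ ℕ => Ideal.Quotient.mk (Ideal.span {f}) (monomial e (1 : k))) '' (T11Char7Fan.A : Set (Fin 4 →₀ ℕ)))) (Ideal.Quotient.mk (Ideal.span {f}) (monomial (T11Char7Fan.m 64) (1 : k))) (Ideal.subset_span ⟨T11Char7Fan.m 64, T11Char7Fan.hmA 64, rfl⟩ : (Ideal.Quotient.mk (Ideal.span {f}) (monomial (T11Char7Fan.m 64) (1 : k))) ∈ (Ideal.span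 ((fun e : Fin 4 →₀ ℕ => Ideal.Quotient.mk (Ideal.span {f}) (monomial e (1 : k))) '' (T11Char7Fan.A : Set (Fin 4 →₀ ℕ)))))⟩ : (affineBlowup (Ideal.span ((fun e : Fin 4 →₀ ℕ => Ideal.Quotient.mk (Ideal.span {f}) (monomial e (1 : k))) '' (T11Char7Fan.A : Set (Fin 4 →₀ ℕ))))).affineOpens)).map (e 64) = (((Ideal.span {x | x ∈ (T11Char3Poly.HS 64).map (KLocCellKit.evalL k)}).map (Ideal.Quotient.mk (Ideal.span {(KLocCellKit.evalL k (T11Char7Poly.G 64))})))).map (θ 64) ∧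
        ((Scheme.IdealSheafData.vanishingIdeal (⟨closure ({ξ} : Set ↥(affineBlowup (Ideal.span ((fun e : Fin 4 →₀ ℕ => Ideal.Quotient.mk (Ideal.span {f}) (monomial e (1 : k))) '' (T11Char7Fan.A : Set (Fin 4 →₀ ℕ)))))), isClosed_closure⟩ : Closeds ↥(affineBlowup (Ideal.span ((fun e : Fin 4 →₀ ℕ => Ideal.Quotient.mk (Ideal.span {f}) (monomial e (1 : k))) '' (T11Char7Fan.A : Set (Fin 4 →₀ ℕ))))))).ideal (⟨(Proj.basicOpen (reesGrading (Ideal.span ((fun e : Fin 4 →₀ ℕ => Ideal.Quotient.mk (Ideal.span {f}) (monomial e (1 : k))) '' (T11Char7Fan.A : Set (Fin 4 →₀ ℕ))))) (reesT (I := (Ideal.span ((fun e : Fin 4 →₀ ℕ => Ideal.Quotient.mk (Ideal.span {f}) (monomial e (1 : k))) '' (T11Char7Fan.A : Set (Fin 4 →₀ ℕ))))) (Ideal.Quotient.mk (Ideal.span {f}) (monomial (T11Char7Fan.m 66) (1 : k))) (Ideal.subset_span ⟨T11Char7Fan.m 66, T11Char7Fan.hmA 66, rfl⟩ : (Ideal.Quotient.mk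 (Ideal.span {f}) (monomial (T11Char7Fan.m 66) (1 : k))) ∈ (Ideal.span ((fun e : Fin 4 →₀ ℕ => Ideal.Quotient.mk (Ideal.span {f}) (monomial e (1 : k))) '' (T11Char7Fan.A : Set (Fin 4 →₀ ℕ))))))), AffineBlowupChartFrame.isAffineOpen_basicOpen_reesT (Ideal.span ((fun e : Fin 4 →₀ ℕ => Ideal.Quotient.mk (Ideal.span {f}) (monomial e (1 : k))) '' (T11Char7Fan.A : Set (Fin 4 →₀ ℕ)))) (Ideal.Quotient.mk (Ideal.span {f}) (monomial (T11Char7Fan.m 66) (1 : k))) (Ideal.subset_span ⟨T11Char7Fan.m 66, T11Char7Fan.hmA 66, rfl⟩ : (Ideal.Quotient.mk (Ideal.span {f}) (monomial (T11Char7Fan.m 66) (1 : k))) ∈ (Ideal.span ((fun e : Fin 4 →₀ ℕ => Ideal.Quotient.mk (Ideal.span {f}) (monomial e (1 : k))) '' (T11Char7Fan.A : Set (Fin 4 →₀ ℕ)))))⟩ : (affineBlowup (Ideal.span ((fun e : Fin 4 →₀ ℕ => Ideal.Quotient.mk (Ideal.span {f}) (monomial e (1 : k))) '' (T11Char7Fan.A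 : Set (Fin 4 →₀ ℕ))))).affineOpens)).map (e 66) = (((Ideal.span {x | x ∈ (T11Char3Poly.HS 66).map (KLocCellKit.evalL k)}).map (Ideal.Quotient.mk (Ideal.span {(KLocCellKit.evalL k (T11Char7Poly.G 66))})))).map (θ 66) ∧
        (∀ x' : ↥(affineBlowup (Ideal.span ((fun e : Fin 4 →₀ ℕ => Ideal.Quotient.mk (Ideal.span {f}) (monomial e (1 : k))) '' (T11Char7Fan.A : Set (Fin 4 →₀ ℕ))))), x' ∈ closure ({ξ} : Set ↥(affineBlowup (Ideal.span ((fun e : Fin 4 →₀ ℕ => Ideal.Quotient.mk (Ideal.span {f}) (monomial e (1 : k))) '' (T11Char7Fan.A : Set (Fin 4 →₀ ℕ)))))) → ∃ c ∈ ({64, 66} : Set (Fin 87)), x' ∈ (Proj.basicOpen (reesGrading (Ideal.span ((fun e : Fin 4 →₀ ℕ => Ideal.Quotient.mk (Ideal.span {f}) (monomial e (1 : k))) '' (T11Char7Fan.A : Set (Fin 4 →₀ ℕ))))) (reesT (I := (Ideal.span ((fun e : Fin 4 →₀ ℕ => Ideal.Quotient.mk (Ideal.span {f}) (monomial e (1 :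 k))) '' (T11Char7Fan.A : Set (Fin 4 →₀ ℕ))))) (Ideal.Quotient.mk (Ideal.span {f}) (monomial (T11Char7Fan.m c) (1 : k))) (Ideal.subset_span ⟨T11Char7Fan.m c, T11Char7Fan.hmA c, rfl⟩ : (Ideal.Quotient.mk (Ideal.span {f}) (monomial (T11Char7Fan.m c) (1 : k))) ∈ (Ideal.span ((fun e : Fin 4 →₀ ℕ => Ideal.Quotient.mk (Ideal.span {f}) (monomial e (1 : k))) '' (T11Char7Fan.A : Set (Fin 4 →₀ ℕ)))))))))
    -- LEVEL-2 BLOCKS on the models of the hon charts 64 and 66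
    (hblock64 : ∃ (t₂ : ℕ) (w₂ : Fin t₂ → (MvPolynomial (Fin 4) k ⧸ Ideal.span {(KLocCellKit.evalL k (T11Char7Poly.G 64))})) (hw₂ : ∀ j : Fin t₂, w₂ j ∈ ((Ideal.span {x | x ∈ (T11Char3Poly.HS 64).map (KLocCellKit.evalL k)}).map (Ideal.Quotient.mk (Ideal.span {(KLocCellKit.evalL k (T11Char7Poly.G 64))})))),
        (HomogeneousIdeal.irrelevant (reesGrading ((Ideal.span {x | x ∈ (T11Char3Poly.HS 64).map (KLocCellKit.evalL k)}).map (Ideal.Quotient.mk (Ideal.span {(KLocCellKit.evalL k (T11Char7Poly.G 64))}))))).toIdeal ≤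
          (Ideal.span (Set.range fun j : Fin t₂ => reesT (I := ((Ideal.span {x | x ∈ (T11Char3Poly.HS 64).map (KLocCellKit.evalL k)}).map (Ideal.Quotient.mk (Ideal.span {(KLocCellKit.evalL k (T11Char7Poly.G 64))})))) (w₂ j) (hw₂ j))).radical ∧
        (∀ j : Fin t₂, w₂ j ≠ 0) ∧
        ∀ (j : Fin t₂) (Q : Ideal (blowupAlgebra ((Ideal.span {x | x ∈ (T11Char3Poly.HS 64).map (KLocCellKit.evalL k)}).map (Ideal.Quotient.mk (Ideal.span {(KLocCellKit.evalL k (T11Char7Poly.G 64))}))) (w₂ j))) [Q.IsMaximal],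
          algebraMap (MvPolynomial (Fin 4) k ⧸ Ideal.span {(KLocCellKit.evalL k (T11Char7Poly.G 64))}) (blowupAlgebra ((Ideal.span {x | x ∈ (T11Char3Poly.HS 64).map (KLocCellKit.evalL k)}).map (Ideal.Quotient.mk (Ideal.span {(KLocCellKit.evalL k (T11Char7Poly.G 64))}))) (w₂ j)) (w₂ j) ∈ Q →
          ∀ dd : ℕ, ringKrullDim (Localization.AtPrime Q) = dd → ∀ s : Fin dd → Localization.AtPrime Q,
          (Ideal.span (Set.range s)).radical.IsMaximal →
            RingTheory.Sequence.IsWeaklyRegular (Localization.AtPrime Q) (List.ofFn s) ∧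
            ∀ y : Localization.AtPrime Q, (∃ e : ℕ, y ^ 3 ^ e ∈ Ideal.span
              ((fun z : Localization.AtPrime Q => z ^ 3 ^ e) ''
                (Ideal.span (Set.range s) : Set (Localization.AtPrime Q)))) → y ∈ Ideal.span (Set.range s))
    (hblock66 : ∃ (t₂ : ℕ) (w₂ : Fin t₂ → (MvPolynomial (Fin 4) k ⧸ Ideal.span {(KLocCellKit.evalL k (T11Char7Poly.G 66))})) (hw₂ : ∀ j : Fin t₂, w₂ j ∈ ((Ideal.span {x | x ∈ (T11Char3Poly.HS 66).map (KLocCellKit.evalL k)}).map (Ideal.Quotient.mk (Ideal.span {(KLocCellKit.evalL k (T11Char7Poly.G 66))})))),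
        (HomogeneousIdeal.irrelevant (reesGrading ((Ideal.span {x | x ∈ (T11Char3Poly.HS 66).map (KLocCellKit.evalL k)}).map (Ideal.Quotient.mk (Ideal.span {(KLocCellKit.evalL k (T11Char7Poly.G 66))}))))).toIdeal ≤
          (Ideal.span (Set.range fun j : Fin t₂ => reesT (I := ((Ideal.span {x | x ∈ (T11Char3Poly.HS 66).map (KLocCellKit.evalL k)}).map (Ideal.Quotient.mk (Ideal.span {(KLocCellKit.evalL k (T11Char7Poly.G 66))})))) (w₂ j) (hw₂ j))).radical ∧
        (∀ j : Fin t₂, w₂ j ≠ 0) ∧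
        ∀ (j : Fin t₂) (Q : Ideal (blowupAlgebra ((Ideal.span {x | x ∈ (T11Char3Poly.HS 66).map (KLocCellKit.evalL k)}).map (Ideal.Quotient.mk (Ideal.span {(KLocCellKit.evalL k (T11Char7Poly.G 66))}))) (w₂ j))) [Q.IsMaximal],
          algebraMap (MvPolynomial (Fin 4) k ⧸ Ideal.span {(KLocCellKit.evalL k (T11Char7Poly.G 66))}) (blowupAlgebra ((Ideal.span {x | x ∈ (T11Char3Poly.HS 66).map (KLocCellKit.evalL k)}).map (Ideal.Quotient.mk (Ideal.span {(KLocCellKit.evalL k (T11Char7Poly.G 66))}))) (w₂ j)) (w₂ j) ∈ Q →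
          ∀ dd : ℕ, ringKrullDim (Localization.AtPrime Q) = dd → ∀ s : Fin dd → Localization.AtPrime Q,
          (Ideal.span (Set.range s)).radical.IsMaximal →
            RingTheory.Sequence.IsWeaklyRegular (Localization.AtPrime Q) (List.ofFn s) ∧
            ∀ y : Localization.AtPrime Q, (∃ e : ℕ, y ^ 3 ^ e ∈ Ideal.span
              ((fun z : Localization.AtPrime Q => z ^ 3 ^ e) ''
                (Ideal.span (Set.range s) : Set (Localization.AtPrime Q)))) → y ∈ Ideal.span (Set.range s))
    (Fs : Fin 2 → MvPolynomial (Fin 5) k) (hF₀ : Fs 0 = X 4 - X 1 ^ 2 - X 0 ^ 3) (hF₁ : Fs 1 = X 2 ^ 2 + X 4 ^ 3 + X 0 ^ 11 + X 3 ^ 7) :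
    ∃ (X' : Scheme.{0}) (π : X' ⟶ (Spec (.of (MvPolynomial (Fin 5) k ⧸ Ideal.span (Set.range Fs))))), IsProper π ∧
      Literature.AlgebraicGeometry.Resolution.IsBirational π ∧
      ∀ x : X', IsDomain (X'.presheaf.stalk x) ∧ ∀ d : ℕ, ringKrullDim (X'.presheaf.stalk x) = d →
        ∀ s : Fin d → X'.presheaf.stalk x, (Ideal.span (Set.range s)).radical.IsMaximal →
          RingTheory.Sequence.IsWeaklyRegular (X'.presheaf.stalk x) (List.ofFn s) ∧
          ∀ y : X'.presheaf.stalk x, (∃ e : ℕ, y ^ 3 ^ e ∈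
            Ideal.span ((fun z : X'.presheaf.stalk x => z ^ 3 ^ e) '' (Ideal.span (Set.range s) : Set (X'.presheaf.stalk x)))) →
            y ∈ Ideal.span (Set.range s) := by
  have h1 := t11_originPointFixable_char3_of_data k f hf hf0 hstd hoff hR3 hblock64 hblock66
  -- all points `b` with `b.asIdeal = 𝔪₀` (there is one) over the `Ideal.span {f}` base
  have h2 : ∀ b : ↥(Spec (.of (MvPolynomial (Fin 4) k ⧸ Ideal.span {f}))), b.asIdeal = Ideal.span (Set.range fun i : Fin 4 => Ideal.Quotient.mk (Ideal.span {f}) (X i)) →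
      ∃ (nc : ℕ) (c : Fin nc → (Spec (.of (MvPolynomial (Fin 4) k ⧸ Ideal.span {f}))).presheaf.stalk b), Ideal.span (Set.range c) ≠ ⊥ ∧
        (Ideal.span (Set.range c)).radical = IsLocalRing.maximalIdeal ((Spec (.of (MvPolynomial (Fin 4) k ⧸ Ideal.span {f}))).presheaf.stalk b) ∧
        ∀ (j : Fin nc) (𝔔 : PrimeSpectrum (blowupAlgebra (Ideal.span (Set.range c)) (c j))),
          𝔔.asIdeal.comap (algebraMap ((Spec (.of (MvPolynomial (Fin 4) k ⧸ Ideal.span {f}))).presheaf.stalk b) (blowupAlgebra (Ideal.span (Set.range c)) (c j))) =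
            IsLocalRing.maximalIdeal ((Spec (.of (MvPolynomial (Fin 4) k ⧸ Ideal.span {f}))).presheaf.stalk b) →
          IsDomain (Localization.AtPrime 𝔔.asIdeal) ∧ ∀ dd : ℕ, ringKrullDim (Localization.AtPrime 𝔔.asIdeal) = dd →
            ∀ s : Fin dd → Localization.AtPrime 𝔔.asIdeal, (Ideal.span (Set.range s)).radical.IsMaximal →
              RingTheory.Sequence.IsWeaklyRegular (Localization.AtPrime 𝔔.asIdeal) (List.ofFn s) ∧
              ∀ y : Localization.AtPrime 𝔔.asIdeal, (∃ e : ℕ, y ^ 3 ^ e ∈ Ideal.span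
                ((fun z : Localization.AtPrime 𝔔.asIdeal => z ^ 3 ^ e) ''
                  (Ideal.span (Set.range s) : Set (Localization.AtPrime 𝔔.asIdeal)))) → y ∈ Ideal.span (Set.range s) := by
    intro b hb
    have hbb : b = ⟨Ideal.span (Set.range fun i : Fin 4 => Ideal.Quotient.mk (Ideal.span {f}) (X i)), (origin_isMaximal f hf0).isPrime⟩ := PrimeSpectrum.ext hb
    subst hbb
    exact h1
  -- move to the `Fin 1`-range base ideal `Ideal.span (Set.range ![f])`
  have h3 : ∀ (J : Ideal (MvPolynomial (Fin 4) k)), J = Ideal.span {f} →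
      ∀ b : ↥(Spec (.of (MvPolynomial (Fin 4) k ⧸ J))), b.asIdeal = Ideal.span (Set.range fun i : Fin 4 => Ideal.Quotient.mk J (X i)) →
      ∃ (nc : ℕ) (c : Fin nc → (Spec (.of (MvPolynomial (Fin 4) k ⧸ J))).presheaf.stalk b), Ideal.span (Set.range c) ≠ ⊥ ∧
        (Ideal.span (Set.range c)).radical = IsLocalRing.maximalIdeal ((Spec (.of (MvPolynomial (Fin 4) k ⧸ J))).presheaf.stalk b) ∧
        ∀ (j : Fin nc) (𝔔 : PrimeSpectrum (blowupAlgebra (Ideal.span (Set.range c)) (c j))),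
          𝔔.asIdeal.comap (algebraMap ((Spec (.of (MvPolynomial (Fin 4) k ⧸ J))).presheaf.stalk b) (blowupAlgebra (Ideal.span (Set.range c)) (c j))) =
            IsLocalRing.maximalIdeal ((Spec (.of (MvPolynomial (Fin 4) k ⧸ J))).presheaf.stalk b) →
          IsDomain (Localization.AtPrime 𝔔.asIdeal) ∧ ∀ dd : ℕ, ringKrullDim (Localization.AtPrime 𝔔.asIdeal) = dd →
            ∀ s : Fin dd → Localization.AtPrime 𝔔.asIdeal, (Ideal.span (Set.range s)).radical.IsMaximal →
              RingTheory.Sequence.IsWeaklyRegular (Localization.AtPrime 𝔔.asIdeal) (List.ofFn s) ∧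
              ∀ y : Localization.AtPrime 𝔔.asIdeal, (∃ e : ℕ, y ^ 3 ^ e ∈ Ideal.span
                ((fun z : Localization.AtPrime 𝔔.asIdeal => z ^ 3 ^ e) ''
                  (Ideal.span (Set.range s) : Set (Localization.AtPrime 𝔔.asIdeal)))) → y ∈ Ideal.span (Set.range s) := by
    intro J hJ
    subst hJ
    exact h2
  have key : Ideal.span (Set.range (![f] : Fin 1 → MvPolynomial (Fin 4) k)) = Ideal.span {f} := by
    rw [T11PlusOriginTransport.range_fin_one]
    rfl
  have h4 := h3 _ key
  -- the origin of the `Fin 1`-range model is prime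
  haveI : (Ideal.span (Set.range fun j : Fin 4 => Ideal.Quotient.mk (Ideal.span (Set.range (![f] : Fin 1 → MvPolynomial (Fin 4) k)))
      (MvPolynomial.X j))).IsPrime :=
    (QuotientOriginMaximal.isMaximal_span_range_mk_X k (![f] : Fin 1 → MvPolynomial (Fin 4) k)
      (fun l => by fin_cases l; exact hf0)).isPrime
  exact T11SpecimenDoorChar3.fInjectiveMacaulayfication_T11plus_char3_of_h0 k Fs hF₀ hF₁
    (T11PlusOriginTransportStalk.t11Plus_h0_of_hypersurface_h0 k 3 Fs hF₀ hF₁ (![f] : Fin 1 → MvPolynomial (Fin 4) k)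
      (by rw [Matrix.cons_val_zero]; exact hf) h4)

end Summit.ResolutionOfSingularities.ResolutionOfSingularities.Theorems.FInjectiveMacaulayfication.T11Char3Frame

end
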